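import Mathlib
import HarnessLib
import Literature.NumberTheory.LFunctions.KMVSignedSecondGap
import Literature.NumberTheory.LFunctions.KMVAmplifiedDiagonalForms
import Summits.Parity.GeneralizedHardyLittlewood.Theses.PrimeLevelFamEdge
import Literature.NumberTheory.Sieve.GallagherGoodLevels

/-!
# Critic sketch (stub-critic seat `scrit-stub_kernelDiagonalUpperOnPrimeAverageXSq`): the typed HEART
# of H⁻ and the provable CORNER piece — signatures only (`sorry`), for STUB-PLAN §5.

`H⁻ = CORNER + HEART`: the registered stub compares `Q^h` with the CONTINUED KMV kernel form
(`kmvKernel`, the `t = 0` residue `½ log(q̂²c²/(m₁m₂))`); the TRUE Petersson diagonal carries instead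
`𝒲(m₁m₂/(c²q̂²))`, `𝒲(y) = Σ_{n≥1} W(n²y)/n`, `W(y) = (1/2πi)∫_{(3)} Γ(1+t)² y^{-t} dt/t`
(KMV2000 p. 12 display, k = 0; Prop. 5.1). CORNER := diagonal(true) − diagonal(continued) is
negligible for `1 < Δ' < 2` (Mellin shift inside the zero-free region, gain `(M/q̂²)^{δ'}`);
HEART := `Q^h −` true diagonal `=` the Kloosterman–Bessel off-diagonal, prime-averaged, one-sided.
No claim about Landau–Siegel zeros.
-/

open Finset Polynomial
open scoped Real

namespace Summit.Parity.GeneralizedHardyLittlewood.Cruxes.BeyondDiagonalBeatsQuarter.DiagonalKernelSplit.Critic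

open Literature.NumberTheory.LFunctions

noncomputable section

/-- KMV's cut-off weight `W(y) = (1/2πi)∫_{(3)} Γ(1+t)² y^{-t} dt/t` in REAL form (inverse Mellin of
`Γ(1+t)²/t`: `W(y) = ∫_{v > y} ∫_{u > 0} e^{-u - v/u} u⁻¹ du dv`, `W(0) = 1`; no Bessel functions). -/
def kmvW (y : ℝ) : ℝ :=
  ∫ v in Set.Ioi y, ∫ u in Set.Ioi (0 : ℝ), Real.exp (-u - v / u) / u

/-- `𝒲(y) = Σ_{n ≥ 1} W(n² y)/n` (Mellin transform `Γ(1+t)² ζ(1+2t)/t`; `𝒲(y) = ½ log(1/y) + E(y)` with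
`E(y) = O(y^{1-ε})` as `y → 0`, and `𝒲(y) = O(e^{-2√y})` for `y ≥ 1`). -/
def kmvWzeta (y : ℝ) : ℝ :=
  ∑' n : ℕ, kmvW (((n : ℝ) + 1) ^ 2 * y) / ((n : ℝ) + 1)

/-- The TRUE diagonal kernel of the second mollified moment at conductor scale `Q = q̂`:
`K_true(a,b) = (ab)⁻¹ Σ_{c ∣ (a,b)} c · τ(ab/c²) · 𝒲(ab/(c²Q²))`; replacing `𝒲(y)` by `½ log(1/y)`
gives exactly `KMV2000.kmvKernel (Real.log Q) a b`. -/
def trueDiagKernel (Q : ℝ) (a b : ℕ) : ℝ :=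
  (∑ c ∈ (Nat.gcd a b).divisors,
      (c : ℝ) * (((a / c) * (b / c)).divisors.card : ℝ) *
        kmvWzeta ((a : ℝ) * b / ((c : ℝ) ^ 2 * Q ^ 2))) / ((a : ℝ) * b)

/-- The stub's mollifier weight at `P = X²`: `x_m = μ(m) ψ(m)⁻¹ (log(M/m)/log M)²`, `M = q̂^{Δ'}`. -/
def xw (Δ' : ℝ) (q m : ℕ) : ℝ :=
  (ArithmeticFunction.moebius m : ℝ) *
    ((KMV2000.psi m)⁻¹ * (X ^ 2 : ℝ[X]).eval
      (Real.log (KMV2000.qhat q ^ Δ' / m) / Real.log (KMV2000.qhat q ^ Δ')))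

/-- **H1 CORNER (support, size L; TRUE, in reach).** For `1 < Δ' < 2` the true diagonal form and the
continued KMV kernel form agree to relative `o(1)` at every large prime level (no average needed):
`|Σ x x (K_true − kmvKernel)| ≤ ε·mainScaleReal/(2q̂)`. -/
def CornerNegligibleXSq : Prop :=
  ∀ Δ' : ℝ, 1 < Δ' → Δ' < 2 → ∀ ε : ℝ, 0 < ε → ∃ q₀ : ℕ, ∀ q : ℕ, q.Prime → q₀ ≤ q →
    |∑ m₁ ∈ Icc 1 ⌊KMV2000.qhat q ^ Δ'⌋₊, ∑ m₂ ∈ Icc 1 ⌊KMV2000.qhat q ^ Δ'⌋₊,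
        xw Δ' q m₁ * xw Δ' q m₂ *
          (trueDiagKernel (KMV2000.qhat q) m₁ m₂ -
            KMV2000.kmvKernel (Real.log (KMV2000.qhat q)) m₁ m₂)| ≤
      ε * KMV2000.mainScaleReal Δ' q / (2 * KMV2000.qhat q)

/-- **H4 HEART (FRONTIER; «IS2000-at-prime-level», (A)-sensitive).** One-sided, prime-averaged
off-diagonal control: `re Σ_{q good prime ∈ (N,2N]} (Q^h(X²,1;q̂^{Δ'}) − 2q̂·Σ x x K_true) ≤ ε Σ mainScale`
on an initial segment `(1, b)`. This is H⁻ with the TRUE diagonal in place of the continued kernel. -/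
def OffDiagonalUpperOnPrimeAverageXSq : Prop :=
  ∃ b : ℝ, 1 < b ∧ ∀ Δ' : ℝ, 1 < Δ' → Δ' < b → ∀ ε : ℝ, 0 < ε → ∃ N₀ : ℕ, ∀ N : ℕ, N₀ ≤ N →
    (∑ q ∈ KMV2000.goodPrimes Δ' N,
        ((if hq : q = 0 then (0 : ℂ) else
            (haveI : NeZero q := ⟨hq⟩; KMV2000.QhPQ q (X ^ 2) 1 (KMV2000.qhat q ^ Δ'))) -
          ((2 * KMV2000.qhat q *
              ∑ m₁ ∈ Icc 1 ⌊KMV2000.qhat q ^ Δ'⌋₊, ∑ m₂ ∈ Icc 1 ⌊KMV2000.qhat q ^ Δ'⌋₊,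
                xw Δ' q m₁ * xw Δ' q m₂ * trueDiagKernel (KMV2000.qhat q) m₁ m₂ : ℝ) : ℂ))).re ≤
      ε * ∑ q ∈ KMV2000.goodPrimes Δ' N, KMV2000.mainScaleReal Δ' q

/-- The registered stub H⁻ (:93–108 of `Lines/diagonal_kernel_split.lean`), restated with `xw`. -/
def KernelDiagonalUpperOnPrimeAverageXSq : Prop :=
  ∃ b : ℝ, 1 < b ∧ ∀ Δ' : ℝ, 1 < Δ' → Δ' < b → ∀ ε : ℝ, 0 < ε → ∃ N₀ : ℕ, ∀ N : ℕ, N₀ ≤ N →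
    (∑ q ∈ KMV2000.goodPrimes Δ' N,
        ((if hq : q = 0 then (0 : ℂ) else
            (haveI : NeZero q := ⟨hq⟩; KMV2000.QhPQ q (X ^ 2) 1 (KMV2000.qhat q ^ Δ'))) -
          ((2 * KMV2000.qhat q *
              ∑ m₁ ∈ Icc 1 ⌊KMV2000.qhat q ^ Δ'⌋₊, ∑ m₂ ∈ Icc 1 ⌊KMV2000.qhat q ^ Δ'⌋₊,
                xw Δ' q m₁ * xw Δ' q m₂ *
                  KMV2000.kmvKernel (Real.log (KMV2000.qhat q)) m₁ m₂ : ℝ) : ℂ))).re ≤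
      ε * ∑ q ∈ KMV2000.goodPrimes Δ' N, KMV2000.mainScaleReal Δ' q

/-- **Recomposition H1 + H4 ⇒ H⁻** (bookkeeping: split `ε = ε/2 + ε/2`, every `q ∈ goodPrimes Δ' N` is a
prime `≥ N + 1 ≥ q₀`; the corner bound summed over the block is `(ε/2)·Σ mainScaleReal`). Left to the
lead if the split is adopted. -/
theorem kernelDiagonalUpper_of_corner_heart
    (h1 : CornerNegligibleXSq) (h4 : OffDiagonalUpperOnPrimeAverageXSq) :
    KernelDiagonalUpperOnPrimeAverageXSq := by
  sorry


/-! ## Post-ideator additions (STUB-PLAN §0/§6): the reshaped target, the clean-scale lever (helper 1). -/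

/-- Block gap `re Σ_{q ∈ goodPrimes Δ' N} (Q^h_q(X²,1;q̂^{Δ'}) − 2q̂·K_q)` — the left side of H⁻ (:93–108). -/
def blockGapRe (Δ' : ℝ) (N : ℕ) : ℝ :=
  (∑ q ∈ KMV2000.goodPrimes Δ' N,
      ((if hq : q = 0 then (0 : ℂ) else
          (haveI : NeZero q := ⟨hq⟩; KMV2000.QhPQ q (X ^ 2) 1 (KMV2000.qhat q ^ Δ'))) -
        ((2 * KMV2000.qhat q *
            ∑ m₁ ∈ Icc 1 ⌊KMV2000.qhat q ^ Δ'⌋₊, ∑ m₂ ∈ Icc 1 ⌊KMV2000.qhat q ^ Δ'⌋₊,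
              xw Δ' q m₁ * xw Δ' q m₂ *
                KMV2000.kmvKernel (Real.log (KMV2000.qhat q)) m₁ m₂ : ℝ) : ℂ))).re

/-- Block main scale `Σ_{q ∈ goodPrimes Δ' N} mainScaleReal Δ' q`. -/
def blockMain (Δ' : ℝ) (N : ℕ) : ℝ :=
  ∑ q ∈ KMV2000.goodPrimes Δ' N, KMV2000.mainScaleReal Δ' q

/-- **H⁻_block,io,U** — the block-averaged, infinitely-often, fixed-tolerance form (what plan Ω proves;
it implies k=2's pointwise `HMinusIO` by «an average ≤ U has a term ≤ U», cf.
`KMV2000.secondDefect_small_io_of_average`). Tolerance `U` strictly below the band slack `4(Δ'−1)/Δ'`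
(`upperSomewhere_X_sq_iff_T₂_band`). -/
def HMinusBlockIO : Prop :=
  ∃ b : ℝ, 1 < b ∧ ∀ Δ' : ℝ, 1 < Δ' → Δ' < b → ∃ U : ℝ, U < 4 * (Δ' - 1) / Δ' ∧
    ∀ N₀ : ℕ, ∃ N : ℕ, N₀ ≤ N ∧ (KMV2000.goodPrimes Δ' N).Nonempty ∧
      blockGapRe Δ' N ≤ U * blockMain Δ' N

/-- **Clean scale.** `N` is `(a₀, η')`-clean when no primitive quadratic character of conductor
`1 < D ≤ N^{η'}` has a real zero in `(1 − a₀/log N, 1)`. (Complex zeros and complex characters are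
automatically `c₀ log N/log(D·3)`-far by the classical zero-free region; only real zeros of real
characters can be `a₀`-close once `η' < c₀/a₀`.) -/
def CleanScale (a₀ η' : ℝ) (N : ℕ) : Prop :=
  ∀ (D : ℕ) [NeZero D] (χ : DirichletCharacter ℂ D), 1 < D → (D : ℝ) ≤ (N : ℝ) ^ η' →
    χ.IsPrimitive → χ ^ 2 = 1 → ∀ β : ℝ, 1 - a₀ / Real.log N < β → β < 1 → χ.LFunction β ≠ 0

/-- **Helper 1 target — clean scales recur (Landau pigeonhole).** For every danger threshold `a₀` there is
`η₀ = c_L/(4a₀)` (`c_L` = the absolute constant of `DirichletZFR.exists_landau_prodChar_min_le`, MV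
Thm 11.7, PROVED in tree) such that for `η' < η₀` clean scales exist beyond every bound. Proof (M):
if all `N ≥ N₀` were dirty with witnesses `(D_N, χ_N, β_N)`, Landau repulsion +
`prodChar_ne_one_of_isPrimitive` force `χ_N = χ_{N'}` whenever `N < N' ≤ N^K`, `K = c_L/(3η'a₀) > 1`;
chaining, ONE character serves all large `N`, so its real zeros accumulate at `1` — impossible for an
entire non-zero `L(s,χ)` (`DirichletCharacter.LFunction_ne_zero_of_one_le_re`, identity theorem). -/
def CleanScalesIO : Prop :=
  ∀ a₀ : ℝ, 0 < a₀ → ∃ η₀ : ℝ, 0 < η₀ ∧ ∀ η' : ℝ, 0 < η' → η' < η₀ →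
    ∀ N₀ : ℕ, ∃ N : ℕ, N₀ ≤ N ∧ CleanScale a₀ η' N

/-- Helper 1 (to be proved; size M; inputs all in tree/Mathlib — see docstring of `CleanScalesIO`). -/
theorem cleanScales_io : CleanScalesIO := by
  intro a₀ ha₀
  obtain ⟨c₀', hc₀', hL⟩ :=
    Literature.NumberTheory.Sieve.MontgomeryVaughan1975.exists_level_without_exceptionalZero
  refine ⟨c₀' / a₀, by positivity, fun η' hη' hη'₀ N₀ ↦ ?_⟩
  have hc : 0 < a₀ * η' := by positivity
  have hcle : a₀ * η' ≤ c₀' := by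
    have := mul_lt_mul_of_pos_left hη'₀ ha₀
    rw [mul_div_cancel₀ _ ha₀.ne'] at this
    exact this.le
  obtain ⟨y, hy, hy2, -, hgood⟩ := hL (a₀ * η') hc hcle η' hη' N₀
  refine ⟨y, hy, ?_⟩
  intro D _ χ hD hDle hprim _ β hβlo hβhi hzero
  apply hgood D χ β
  have hypos : (0 : ℝ) < y := by exact_mod_cast (by omega : 0 < y)
  have hlog : Real.log ((y : ℝ) ^ η') = η' * Real.log y := Real.log_rpow hypos η'
  refine ⟨hprim, ?_, hDle, ?_, hβhi, hzero⟩
  · intro h1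
    subst h1
    rw [DirichletCharacter.isPrimitive_def, DirichletCharacter.conductor_one] at hprim
    omega
  · rw [hlog]
    have : a₀ * η' / (η' * Real.log y) = a₀ / Real.log y := by
      rw [mul_comm η', mul_div_mul_right _ _ hη'.ne']
    rw [this]
    exact hβlo.le

/-- **Plan Ω's analytic target**: at CLEAN scales the block gap is at most `U·Σ mainScale`, `U` below the
slack — the exceptional/near-`1` resonance is then `≤ e^{-a₀}`-damped (gate G2), the q-free constant is
`c_zero(Δ') ≤ 0` (gate G1), the Titchmarsh-family errors are `o(Σ mainScale)` (helpers 4–6). The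
quantifier shape lets the analyst pick `a₀` first and then demand `η' < η₀(a₀)` (window `b ≤ 1 + η₀/2`). -/
def HMinusBlockAtCleanScales : Prop :=
  ∃ a₀ : ℝ, 0 < a₀ ∧ ∀ η₀ : ℝ, 0 < η₀ → ∃ b : ℝ, 1 < b ∧ ∀ Δ' : ℝ, 1 < Δ' → Δ' < b →
    ∃ U : ℝ, U < 4 * (Δ' - 1) / Δ' ∧ ∃ η' : ℝ, 0 < η' ∧ η' < η₀ ∧ ∃ N₀ : ℕ, ∀ N : ℕ, N₀ ≤ N →
      CleanScale a₀ η' N → (KMV2000.goodPrimes Δ' N).Nonempty ∧ blockGapRe Δ' N ≤ U * blockMain Δ' N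

/-- Composition Ω-h (pure logic): clean-scale control + recurrence of clean scales ⇒ H⁻_block,io,U. -/
theorem hMinusBlockIO_of_cleanScales (hΩ : HMinusBlockAtCleanScales) (hc : CleanScalesIO) :
    HMinusBlockIO := by
  obtain ⟨a₀, ha₀, H⟩ := hΩ
  obtain ⟨η₀, hη₀, Hc⟩ := hc a₀ ha₀
  obtain ⟨b, hb, Hb⟩ := H η₀ hη₀
  refine ⟨b, hb, fun Δ' h1 h2 ↦ ?_⟩
  obtain ⟨U, hU, η', hη', hη'₀, N₀, HN⟩ := Hb Δ' h1 h2
  refine ⟨U, hU, fun N₁ ↦ ?_⟩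
  obtain ⟨N, hN, hclean⟩ := Hc η' hη' hη'₀ (max N₀ N₁)
  exact ⟨N, le_trans (le_max_right _ _) hN, HN N (le_trans (le_max_left _ _) hN) hclean⟩

end

end Summit.Parity.GeneralizedHardyLittlewood.Cruxes.BeyondDiagonalBeatsQuarter.DiagonalKernelSplit.Critic
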